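import Summits.Ventures.HSemireg.WedgeHankelDivisorMirror
import Summits.Ventures.HSemireg.WedgeHankelDivisorIntersectionTop
import Summits.Ventures.HSemireg.WedgeHankelDivisorTopKernel

/-!
# Venture HSemireg — THE P¹ VERSION OF THE EVERY-DEGREE COUNTS: for a divisor on P¹ of total order `D ≤ k + 1` (distinct finite nodes of exact orders `P_i`, a node at `∞` of exact
# order `P∞`, all `≤ k′`, `k + k′ = n`) the finite node images are independent and meet the image of the node at `∞` in `0`, the node kernels are in general position
# (`dim = C(2n,k) − D·C(n,k)`), and F3b's kernel law holds IFF `D ≤ n + 1 − k`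

HONEST FRAMING. Part of the Lean index of the computation cell `pub-hsemireg` (seat p10 gen 17, Sunday typer «UNIFORM-IN-n»).
Finite-dimensional EXTERIOR ALGEBRA over a field + ranks of Hankel matrices ONLY: no variety, no cohomology theory, no sheaf, no Ext group, no semiregularity map;
nothing here says that HC / HC_CM / HC_AV holds; no Literature fact is declared or used.  Custodian versions as in `WedgeHankelSiegelIdeal` (1/3) and
`WedgeKernelDuality`; the dictionary (the node at `∞` of order `P∞ + 1` ↦ `w_n(rev_n q∞)`; the divisor `Σ_i (P_i+1)[λ_i] + (P∞+1)[∞]`) is QUOTED, never asserted.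

WHAT IS IN THE TREE.  F3b `Kr_w_expMul_sum_add_rev` and its count (P¹ divisor kernel = intersection of node kernels, `D ≤ k+1`, `D ≤ n+1−k`), F3c (images), G5 `coSiegel_decomposition_top` (this seat:
independence + disjointness at total order EXACTLY `k + 1`), G8 (finite divisors: independence in every degree by multiplying with monomials, `Hom_mul_V_le`,
`eq_zero_of_forall_B_mul_left_eq_zero`), G9 (the mirror rank on P¹).  THIS FILE (namespace `Summit.Ventures.HSemireg.Wedge.KernelDuality` continued; imports G9, G5, F3b):
* §113 **`disjoint_iSup_V_w_expMul_V_w_rev`**: for `D = Σ_i (P_i+1) + (P∞+1) ≤ k + 1` and all orders `≤ k′` the sum of the finite node images meets the image of the node at `∞` in `0`, in EVERY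
  degree `k′` (G5 in degree `n + 1 − D`, pulled down by monomials as in G8); with G8's independence of the finite part: **`finrank_iSup_V_sup_V_rev_eq`: `dim((⨆_i V_i) ⊔ V_∞) = D·C(n,k)`**
  and the dual COUNT **`finrank_iInf_Kr_inf_Kr_rev_add`: `dim((⋂_i Kr_i) ⊓ Kr_∞) + D·C(n,k) = C(2n,k)`** — F3b's general position with NO `D ≤ n + 1 − k`.
* §114 the P¹ DICHOTOMY **`Kr_w_expMul_sum_add_rev_eq_iInf_inf_iff`: for `D ≤ k + 1`, `Kr(P¹ class) = (⋂_i Kr_i) ⊓ Kr_∞` ⟺ `D ≤ n + 1 − k`** (G9's mirror rank on P¹ + THEOREM H + §113):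
  F3b's hypothesis is sharp; `iInf_Kr_inf_Kr_rev_lt_Kr_w_sum_add_rev` (strict in the mirror range).
NOT typed here: P¹ divisor Torelli (reading the node at `∞` and its order off the intersection; same pattern as G8 §108 with `Fin.cons`/order raising — mechanical); anything Ext-side.
Class side only; new names only.
-/

open Module

namespace Summit.Ventures.HSemireg.Wedge.KernelDuality

open Summit.Ventures.HSemireg.Wedge Summit.Ventures.HSemireg.Wedge.Kunneth Summit.Ventures.HSemireg.Wedge.Hankel
  Summit.Ventures.HSemireg.Wedge.HankelSiegel Summit.Ventures.HSemireg.Wedge.HankelSiegelIdeal Summit.Ventures.HSemireg.Wedge.KunnethKernel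
  Summit.Ventures.HSemireg.Wedge.HankelSecant Summit.Ventures.HSemireg.Wedge.HankelFrameChange Summit.Ventures.HSemireg.Wedge.HankelPureKernel

variable (K : Type*) [Field K] {n : ℕ}

/-! ## §113. The finite node images meet the image of the node at `∞` in `0`, in every degree -/

/-- left multiplication by a monomial maps an image into the image in the higher degree (G8's `Hom_mul_V_le`, element form). -/
lemma B_mul_mem_V {e a : ℕ} {U : Finset (In n)} (hU : U.card = e) (f : HT K (In n)) {y : HT K (In n)} (hy : y ∈ V K (In n) Finset.univ f a) :
    B K (In n) U * y ∈ V K (In n) Finset.univ f (e + a) :=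
  Hom_mul_V_le K e a f (Submodule.mul_mem_mul (B_mem_Hom K (Finset.subset_univ U) hU) hy)

/-- left multiplication by a monomial maps a sum of images into the sum of the images in the higher degree. -/
lemma B_mul_mem_iSup_V {e a r : ℕ} {U : Finset (In n)} (hU : U.card = e) (f : Fin r → HT K (In n)) {y : HT K (In n)} (hy : y ∈ ⨆ i, V K (In n) Finset.univ (f i) a) :
    B K (In n) U * y ∈ ⨆ i, V K (In n) Finset.univ (f i) (e + a) := by
  have hle : (⨆ i, V K (In n) Finset.univ (f i) a) ≤ (⨆ i, V K (In n) Finset.univ (f i) (e + a)).comap (LinearMap.mulLeft K (B K (In n) U)) :=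
    iSup_le fun i => fun z hz => by
      rw [Submodule.mem_comap, LinearMap.mulLeft_apply]
      exact Submodule.mem_iSup_of_mem i (B_mul_mem_V K hU _ hz)
  have := hle hy
  rwa [Submodule.mem_comap, LinearMap.mulLeft_apply] at this

/-- **THE FINITE NODE IMAGES MEET THE IMAGE OF THE NODE AT `∞` IN `0`, IN EVERY DEGREE**: distinct `λ_i`, exact orders `P_i ≤ k′`, `q∞` of exact order `P∞ ≤ k′`,
`D = Σ_i (P_i+1) + (P∞+1) ≤ k + 1` (`k + k′ = n`) ⇒ `Disjoint (⨆_i V(univ, w_n(expMul λ_i q_i), k′)) (V(univ, w_n(rev_n q∞), k′))` — G5's disjointness in degree `n + 1 − D`, pulled down by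
multiplying with monomials of degree `k + 1 − D` (G8 §106). -/
theorem disjoint_iSup_V_w_expMul_V_w_rev {k k' r : ℕ} (hkk' : k + k' = n) {lam : Fin r → K} (hlam : Function.Injective lam) {P : Fin r → ℕ} {q : Fin r → ℕ → K}
    (hq : ∀ i j, P i < j → q i j = 0) (hqP : ∀ i, q i (P i) ≠ 0) (hPk' : ∀ i, P i ≤ k') {Pinf : ℕ} {qinf : ℕ → K} (hqi : ∀ j, Pinf < j → qinf j = 0)
    (hqiP : qinf Pinf ≠ 0) (hPinfk' : Pinf ≤ k') (hD : ∑ i, (P i + 1) + (Pinf + 1) ≤ k + 1) :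
    Disjoint (⨆ i, V K (In n) Finset.univ (w K n n (expMul K (lam i) (q i))) k') (V K (In n) Finset.univ (w K n n (rev K n qinf)) k') := by
  set D := ∑ i, (P i + 1) + (Pinf + 1) with hDdef
  set e := k + 1 - D with he
  -- G5 in degree e + k′ = n + 1 − D
  have hbig := (coSiegel_decomposition_top K (n := n) (k := D - 1) (k' := e + k') (by omega) hlam hq hqP (fun i => (hPk' i).trans (Nat.le_add_left _ _)) hqi hqiP
    (hPinfk'.trans (Nat.le_add_left _ _)) (by omega)).2.2
  rw [disjoint_iff, eq_bot_iff] at hbig ⊢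
  intro x hx
  obtain ⟨hx1, hx2⟩ := Submodule.mem_inf.mp hx
  have hxH : x ∈ Hom K (In n) Finset.univ (k' + n) := V_le_Hom K (by simpa only [Dm_top] using w_mem_Hom K (le_refl n) (rev K n qinf)) k' hx2
  rw [Submodule.mem_bot]
  refine eq_zero_of_forall_B_mul_left_eq_zero K (e := e) (by rw [Fintype.card_fin]; omega) hxH fun U hU => ?_
  exact (Submodule.mem_bot K).mp (hbig (Submodule.mem_inf.mpr ⟨B_mul_mem_iSup_V K hU _ hx1, B_mul_mem_V K hU _ hx2⟩))

/-- **`dim((⨆_i V_i) ⊔ V_∞) = D·C(n,k)`** for such a divisor on `P¹` (`D ≤ k + 1`; G8's independence of the finite part + §113 + F3c's dimension of `V_∞`). -/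
theorem finrank_iSup_V_sup_V_rev_eq {k k' r : ℕ} (hkk' : k + k' = n) {lam : Fin r → K} (hlam : Function.Injective lam) {P : Fin r → ℕ} {q : Fin r → ℕ → K}
    (hq : ∀ i j, P i < j → q i j = 0) (hqP : ∀ i, q i (P i) ≠ 0) (hPk' : ∀ i, P i ≤ k') {Pinf : ℕ} {qinf : ℕ → K} (hqi : ∀ j, Pinf < j → qinf j = 0)
    (hqiP : qinf Pinf ≠ 0) (hPinfk' : Pinf ≤ k') (hD : ∑ i, (P i + 1) + (Pinf + 1) ≤ k + 1) :
    finrank K ↥((⨆ i, V K (In n) Finset.univ (w K n n (expMul K (lam i) (q i))) k') ⊔ V K (In n) Finset.univ (w K n n (rev K n qinf)) k') =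
      (∑ i, (P i + 1) + (Pinf + 1)) * n.choose k := by
  have hchoose : n.choose k' = n.choose k := by rw [← Nat.choose_symm (show k ≤ n by omega), show n - k = k' by omega]
  have h1 := Submodule.finrank_sup_add_finrank_inf_eq (⨆ i, V K (In n) Finset.univ (w K n n (expMul K (lam i) (q i))) k') (V K (In n) Finset.univ (w K n n (rev K n qinf)) k')
  rw [disjoint_iff.mp (disjoint_iSup_V_w_expMul_V_w_rev K hkk' hlam hq hqP hPk' hqi hqiP hPinfk' hD), finrank_bot, add_zero,
    finrank_iSup_V_w_expMul_eq K hkk' hlam hq hqP hPk' (by omega), HankelFrameChange.finrank_V_w_rev_of_order K hPinfk' (by omega) hqi hqiP, hchoose] at h1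
  rw [h1]; ring

/-- the annihilator of the P¹ image sum is the P¹ kernel intersection (E1). -/
lemma Ann_iSup_V_sup_V_rev_eq {k k' r : ℕ} (hkk' : k + k' = n) (hr : 0 < r) (q : Fin r → ℕ → K) (qinf : ℕ → K) :
    Ann K k ((⨆ i, V K (In n) Finset.univ (w K n n (q i)) k') ⊔ V K (In n) Finset.univ (w K n n (rev K n qinf)) k') =
      (⨅ i, Kr K Finset.univ (w K n n (q i)) k) ⊓ Kr K Finset.univ (w K n n (rev K n qinf)) k := by
  rw [Ann_sup, Ann_iSup_V_w_eq_iInf_Kr K hkk' hr, ← Kr_w_eq_Ann K hkk']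

/-- **NODE KERNELS ON `P¹` IN GENERAL POSITION IN EVERY DEGREE: `dim((⋂_i Kr(univ, w_n(expMul λ_i q_i), k)) ⊓ Kr(univ, w_n(rev_n q∞), k)) + D·C(n,k) = C(2n,k)`** for distinct `λ_i`,
exact orders with `k + P_i ≤ n`, `k + P∞ ≤ n`, total order `D ≤ k + 1` — F3b's count with NO `D ≤ n + 1 − k`. -/
theorem finrank_iInf_Kr_inf_Kr_rev_add {k r : ℕ} {lam : Fin r → K} (hlam : Function.Injective lam) {P : Fin r → ℕ} {q : Fin r → ℕ → K}
    (hq : ∀ i j, P i < j → q i j = 0) (hqP : ∀ i, q i (P i) ≠ 0) (hkP : ∀ i, k + P i ≤ n) {Pinf : ℕ} {qinf : ℕ → K} (hqi : ∀ j, Pinf < j → qinf j = 0)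
    (hqiP : qinf Pinf ≠ 0) (hkPinf : k + Pinf ≤ n) (hD : ∑ i, (P i + 1) + (Pinf + 1) ≤ k + 1) (hr : 0 < r) :
    finrank K ↥((⨅ i, Kr K Finset.univ (w K n n (expMul K (lam i) (q i))) k) ⊓ Kr K Finset.univ (w K n n (rev K n qinf)) k) +
      (∑ i, (P i + 1) + (Pinf + 1)) * n.choose k = (n + n).choose k := by
  have hkk' : k + (n - k) = n := by omega
  rw [← Ann_iSup_V_sup_V_rev_eq K hkk' hr, ← finrank_iSup_V_sup_V_rev_eq K hkk' hlam hq hqP (fun i => by have := hkP i; omega) hqi hqiP (by omega) hD]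
  have h := finrank_Ann_add K (a := k) (b := n - k + n) (I := In n) (by rw [Fintype.card_fin]; omega)
    (W := (⨆ i, V K (In n) Finset.univ (w K n n (expMul K (lam i) (q i))) (n - k)) ⊔ V K (In n) Finset.univ (w K n n (rev K n qinf)) (n - k))
    (sup_le (iSup_le fun i => (V_w_le_coSiegel K hkk' _).trans (coSiegel_le_Hom K _)) ((V_w_le_coSiegel K hkk' _).trans (coSiegel_le_Hom K _)))
  rwa [Fintype.card_fin] at h

/-! ## §114. The P¹ dichotomy: F3b's kernel law holds iff `D ≤ n + 1 − k` -/

/-- `dim Kr(univ, P¹ class, k) + min(D, n+1−k)·C(n,k) = C(2n,k)` for `D ≤ k + 1` (THEOREM H with G9's mirror rank on `P¹`). -/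
theorem finrank_Kr_w_expMul_sum_add_rev_of_le {k r : ℕ} (hk : k ≤ n) {lam : Fin r → K} (hlam : Function.Injective lam) {P : Fin r → ℕ} {q : Fin r → ℕ → K}
    (hq : ∀ i j, P i < j → q i j = 0) (hqP : ∀ i, q i (P i) ≠ 0) {Pinf : ℕ} {qinf : ℕ → K} (hqi : ∀ j, Pinf < j → qinf j = 0) (hqiP : qinf Pinf ≠ 0)
    (hDk : ∑ i, (P i + 1) + (Pinf + 1) ≤ k + 1) :
    finrank K (Kr K Finset.univ (w K n n (fun j => (∑ i, expMul K (lam i) (q i) j) + rev K n qinf j)) k) +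
      min (∑ i, (P i + 1) + (Pinf + 1)) (n + 1 - k) * n.choose k = (n + n).choose k := by
  have h := finrank_Kr_w_add_rank K (n := n) k (fun j => (∑ i, expMul K (lam i) (q i) j) + rev K n qinf j)
  rw [rank_hankel1_expMul_sum_add_rev_eq_min₃ K hk hlam hq hqP hqi hqiP (Or.inl hDk), Nat.mul_comm] at h
  rcases le_total (∑ i, (P i + 1) + (Pinf + 1)) (n + 1 - k) with h' | h'
  · rw [min_eq_left (le_min hDk h')] at h
    rw [min_eq_left h']; exact h
  · rw [min_eq_right h']
    rwa [min_eq_right (show min (k + 1) (n + 1 - k) ≤ _ from (min_le_right _ _).trans h'), min_eq_right (by omega : n + 1 - k ≤ k + 1)] at h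

/-- **IN THE MIRROR RANGE ON `P¹` THE CLASS KERNEL IS STRICTLY BIGGER THAN THE INTERSECTION OF THE NODE KERNELS** (`n + 1 − k < D ≤ k + 1`, names `k + P ≤ n`). -/
theorem iInf_Kr_inf_Kr_rev_lt_Kr_w_sum_add_rev {k r : ℕ} {lam : Fin r → K} (hlam : Function.Injective lam) {P : Fin r → ℕ} {q : Fin r → ℕ → K}
    (hq : ∀ i j, P i < j → q i j = 0) (hqP : ∀ i, q i (P i) ≠ 0) (hkP : ∀ i, k + P i ≤ n) {Pinf : ℕ} {qinf : ℕ → K} (hqi : ∀ j, Pinf < j → qinf j = 0)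
    (hqiP : qinf Pinf ≠ 0) (hkPinf : k + Pinf ≤ n) (hDlo : n + 1 - k < ∑ i, (P i + 1) + (Pinf + 1)) (hDk : ∑ i, (P i + 1) + (Pinf + 1) ≤ k + 1) (hr : 0 < r) :
    (⨅ i, Kr K Finset.univ (w K n n (expMul K (lam i) (q i))) k) ⊓ Kr K Finset.univ (w K n n (rev K n qinf)) k <
      Kr K Finset.univ (w K n n (fun j => (∑ i, expMul K (lam i) (q i) j) + rev K n qinf j)) k := by
  have hk : k ≤ n := by omega
  refine lt_of_le_of_ne (HankelFrameChange.iInf_Kr_le_Kr_w_sum_add_rev K _ qinf k) fun heq => ?_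
  have h1 := finrank_iInf_Kr_inf_Kr_rev_add K hlam hq hqP hkP hqi hqiP hkPinf hDk hr
  have h2 := finrank_Kr_w_expMul_sum_add_rev_of_le K hk hlam hq hqP hqi hqiP hDk
  rw [heq] at h1
  rw [min_eq_right (by omega : n + 1 - k ≤ ∑ i, (P i + 1) + (Pinf + 1))] at h2
  have hpos : 0 < n.choose k := Nat.choose_pos hk
  have : (∑ i, (P i + 1) + (Pinf + 1)) * n.choose k = (n + 1 - k) * n.choose k := by omega
  have := Nat.eq_of_mul_eq_mul_right hpos this
  omega

/-- **THE P¹ DICHOTOMY: for a divisor on `P¹` of total order `D ≤ k + 1` (at least one finite node; `k + P ≤ n`), `Kr(univ, class, k) = (⋂_i Kr(node i)) ⊓ Kr(node ∞)` ⟺ `D ≤ n + 1 − k`**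
— F3b's hypothesis is exactly the range of validity. -/
theorem Kr_w_expMul_sum_add_rev_eq_iInf_inf_iff {k r : ℕ} (hr : 0 < r) {lam : Fin r → K} (hlam : Function.Injective lam) {P : Fin r → ℕ} {q : Fin r → ℕ → K}
    (hq : ∀ i j, P i < j → q i j = 0) (hqP : ∀ i, q i (P i) ≠ 0) (hkP : ∀ i, k + P i ≤ n) {Pinf : ℕ} {qinf : ℕ → K} (hqi : ∀ j, Pinf < j → qinf j = 0)
    (hqiP : qinf Pinf ≠ 0) (hkPinf : k + Pinf ≤ n) (hDk : ∑ i, (P i + 1) + (Pinf + 1) ≤ k + 1) :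
    Kr K Finset.univ (w K n n (fun j => (∑ i, expMul K (lam i) (q i) j) + rev K n qinf j)) k =
        (⨅ i, Kr K Finset.univ (w K n n (expMul K (lam i) (q i))) k) ⊓ Kr K Finset.univ (w K n n (rev K n qinf)) k ↔
      ∑ i, (P i + 1) + (Pinf + 1) ≤ n + 1 - k := by
  constructor
  · intro h
    by_contra hlt
    exact (iInf_Kr_inf_Kr_rev_lt_Kr_w_sum_add_rev K hlam hq hqP hkP hqi hqiP hkPinf (by omega) hDk hr).ne h.symm
  · intro h
    rw [HankelFrameChange.Kr_w_expMul_sum_add_rev K hlam hq hqP hqi hqiP hDk h, HankelFrameChange.Kr_w_rev_of_order K hkPinf hqi hqiP]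
    refine congrArg (· ⊓ _) (iInf_congr fun i => ?_)
    rw [Kr_w_expMul_of_order K (lam i) (hkP i) (hq i) (hqP i)]

end Summit.Ventures.HSemireg.Wedge.KernelDuality
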